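import Summits.Ventures.HSemireg.MixedFrameClassDead
import Summits.Ventures.HSemireg.EdgeLeadingDigit

/-!
# The (1,2,3,3,3,3) mixed frame is CLASS-DEAD for EVERY integral class 2-form (pub-hsemireg, S4-PUSH corner 2)

Kernel leg of seat s4-search-2 gen 17 (cell `pub-hsemireg`), ROW V; the mixed-frame analogue of ROWS T ∕ U for ROW K
(`MixedFrameClassDead.mixedFrame_classDead`: dual type `c′ = (1,2,3,3,3,3)`, `D = 2h₀ + 4h₁ + 8S₁`,
`D₂ = 8h₀h₁ + 16h₀S₁ + 32h₁S₁ + 64S₂`, `σ₁ = 0`, `σ₂ = 4t + 2`, `σ₀ = 2s + 1`, 63 classes).  For this type the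
registered `T₂` is `16(B₂ + h₀h₁) + 32W₁`, so CRITERION L at `k = 2` forces `B₂ = −h₀h₁ + 2W₀`, i.e.
`B·B = 2·x₀x₁x₂x₃ + 4(W₀ − h₀h₁)` — the same congruence as for the edge unit; ROW S's parities and support lemma and
ROW T's `split_slotPair` then produce ROW K's leading digit `C` on the slot pair with odd Pfaffian
(`mixed_leadingDigit_of_criterionL_two`), and ROW K applies verbatim (`mixedFrame_classDead_of_mem_span`: ROW K's
theorem with `hC ∕ hp ∕ hX ∕ hB` REPLACED by `mB : B ∈ span`).

Scope ∕ honest framing as in ROW K: CLASS-LEVEL, NECESSARY-condition bookkeeping (CRITERION L) at the special fibre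
`E⁶`; CRITERION L as the registered necessary condition, the signature table and the census remain framework words;
theorems only (count-neutral, no `def`); no object, no `σ` computation, no Hodge statement; nothing here bears on
HC ∕ HC_CM ∕ HC_AV.
-/

namespace Summit.Ventures.HSemireg.MixedFrameEveryDigit

open ExteriorAlgebra DecomposableTwoForms EdgeDigitSupport EdgeLeadingDigit MixedFrameClassDead

variable {M : Type*} [AddCommGroup M] [Module ℤ M]

/-- **The mixed frame's leading digit from CRITERION L at `k = 2`.**  For ANY `B` in the `ℤ`-span of the 2-vectors
with `B·B = 2B₂`, in the setting of ROW K: `T₂ = 64·Z₂` forces `B = C + 2X` with `C` integral on the slot pair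
`x₀, …, x₃` with ODD Pfaffian and `X` in the span of the 2-vectors. -/
theorem mixed_leadingDigit_of_criterionL_two (x : Module.Basis (Fin 12) ℤ M)
    (h₀ h₁ l₁ l₂ l₃ l₄ h₂ h₃ h₄ h₅ σ₀ σ₁ σ₂ s t S₁ S₂ D D₂ B B₂ T₂ Z₂ : ExteriorAlgebra ℤ M)
    (hh₀ : h₀ = ι ℤ (x 0) * ι ℤ (x 1)) (hh₁ : h₁ = ι ℤ (x 2) * ι ℤ (x 3)) (hl₁ : l₁ = ι ℤ (x 0) * ι ℤ (x 2))
    (hl₂ : l₂ = ι ℤ (x 0) * ι ℤ (x 3)) (hl₃ : l₃ = ι ℤ (x 1) * ι ℤ (x 2)) (hl₄ : l₄ = ι ℤ (x 1) * ι ℤ (x 3))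
    (_hh₂ : h₂ = ι ℤ (x 4) * ι ℤ (x 5)) (_hh₃ : h₃ = ι ℤ (x 6) * ι ℤ (x 7)) (_hh₄ : h₄ = ι ℤ (x 8) * ι ℤ (x 9))
    (_hh₅ : h₅ = ι ℤ (x 10) * ι ℤ (x 11))
    (_hS₁ : S₁ = h₂ + h₃ + h₄ + h₅) (_hS₂ : S₂ = h₂ * h₃ + h₂ * h₄ + h₂ * h₅ + h₃ * h₄ + h₃ * h₅ + h₄ * h₅)
    (_hD : D = 2 * h₀ + 4 * h₁ + 8 * S₁) (hD₂ : D₂ = 8 * (h₀ * h₁) + 16 * (h₀ * S₁) + 32 * (h₁ * S₁) + 64 * S₂)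
    (mB : B ∈ Submodule.span ℤ (Set.range fun p : M × M => ι ℤ p.1 * ι ℤ p.2)) (qB : B * B = 2 * B₂)
    (hσ₁ : σ₁ = 0) (hσ₂ : σ₂ = 4 * t + 2) (hσ₀ : σ₀ = 2 * s + 1)
    (hT₂ : T₂ = σ₂ * D₂ - 4 * σ₁ * (D * B) + 16 * σ₀ * B₂) (hcrit : T₂ = 64 * Z₂) :
    ∃ β₀₁ β₂₃ n₁ n₂ n₃ n₄ p : ℤ, ∃ X ∈ Submodule.span ℤ (Set.range fun p : M × M => ι ℤ p.1 * ι ℤ p.2),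
      B = ((β₀₁ : ExteriorAlgebra ℤ M) * h₀ + (β₂₃ : ExteriorAlgebra ℤ M) * h₁
        + ((n₁ : ExteriorAlgebra ℤ M) * l₁ + (n₂ : ExteriorAlgebra ℤ M) * l₂ + (n₃ : ExteriorAlgebra ℤ M) * l₃
          + (n₄ : ExteriorAlgebra ℤ M) * l₄)) + 2 * X ∧
      β₀₁ * β₂₃ + (n₂ * n₃ - n₁ * n₄) = 2 * p + 1 := by
  -- `T₂ = 16(B₂ + h₀h₁) + 32W₁`
  obtain ⟨W₁, hW₁⟩ : ∃ W₁ : ExteriorAlgebra ℤ M, W₁ = t * (h₀ * h₁) + 2 * t * (h₀ * S₁) + h₀ * S₁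
      + (4 * t + 2) * (h₁ * S₁) + (8 * t + 4) * S₂ + s * B₂ := ⟨_, rfl⟩
  have e : T₂ = 32 * W₁ + 16 * (B₂ + h₀ * h₁) := by
    rw [hW₁, hT₂, hσ₁, hσ₂, hσ₀, hD₂]; noncomm_ring
  have h16 : (16 : ExteriorAlgebra ℤ M) * (B₂ + h₀ * h₁) = 16 * (2 * (2 * Z₂ - W₁)) := by
    rw [eq_sub_of_add_eq' (e.symm.trans hcrit)]; noncomm_ring
  have hB₂ : B₂ = -(h₀ * h₁) + 2 * (2 * Z₂ - W₁) := by
    have h := LeadingDigitRemainder.natCast_mul_cancel x 16 (by norm_num) _ _ (by exact_mod_cast h16)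
    rw [← h]; abel
  have hBB : B * B = 2 * (ι ℤ (x 0) * ι ℤ (x 1) * (ι ℤ (x 2) * ι ℤ (x 3))) + 4 * (2 * Z₂ - W₁ - h₀ * h₁) := by
    rw [qB, hB₂, hh₀, hh₁]; noncomm_ring
  -- coefficient array and the parities of its Pfaffians
  obtain ⟨c, h0, hskew, hBc⟩ := exists_coeff_of_mem_span x B mB
  have hodd := pfaffian_odd_of_sq x c h0 hskew B _ hBc (i := 0) (j := 1) (k := 2) (l := 3)
    (by decide) (by decide) (by decide) (by decide) (by decide) (by decide) hBB
  have heven := fun i j k l hm => pfaffian_even_of_sq_outside x c h0 hskew B _ hBc 0 1 2 3 hBB i j k l hm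
  -- over `𝔽₂` the array is supported on `{0, 1, 2, 3}`
  have hsupp : ∀ a b : Fin 12, a ≠ 0 → a ≠ 1 → a ≠ 2 → a ≠ 3 → (2 : ℤ) ∣ c a b := by
    intro a b g₀ g₁ g₂ g₃
    have h := support_of_pfaffians (K := ZMod 2) (fun a b => ((c a b : ℤ) : ZMod 2))
      (fun i j => by simp only [hskew i j, Int.cast_neg]) 0 1 2 3 (by decide) (by decide) (by decide) (by decide)
      (by decide) (by decide)
      (by
        intro h
        apply hodd
        refine (ZMod.intCast_zmod_eq_zero_iff_dvd _ 2).mp ?_ |> fun h2 => by exact_mod_cast h2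
        push_cast; exact h)
      (by
        intro i j k l hm
        have h2 := heven i j k l hm
        have h3 := (ZMod.intCast_zmod_eq_zero_iff_dvd _ 2).mpr (by exact_mod_cast h2)
        push_cast at h3; exact h3)
      a b g₀ g₁ g₂ g₃
    have h3 := (ZMod.intCast_zmod_eq_zero_iff_dvd (c a b) 2).mp h
    exact_mod_cast h3
  have hsupp' : ∀ a b : Fin 12, b ≠ 0 → b ≠ 1 → b ≠ 2 → b ≠ 3 → (2 : ℤ) ∣ c a b := by
    intro a b g₀ g₁ g₂ g₃
    rw [hskew b a]
    exact (hsupp b a g₀ g₁ g₂ g₃).neg_right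
  obtain ⟨X, mX, hX⟩ := split_slotPair x c hsupp hsupp'
  have hp : Odd (c 0 1 * c 2 3 - c 0 2 * c 1 3 + c 0 3 * c 1 2) := by
    rcases Int.even_or_odd (c 0 1 * c 2 3 - c 0 2 * c 1 3 + c 0 3 * c 1 2) with h | h
    · exact absurd (even_iff_two_dvd.mp h) hodd
    · exact h
  obtain ⟨p, hp⟩ := hp
  refine ⟨c 0 1, c 2 3, c 0 2, c 0 3, c 1 2, c 1 3, p, X, mX, ?_, by linear_combination hp⟩
  rw [hh₀, hh₁, hl₁, hl₂, hl₃, hl₄, hBc, hX]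

set_option maxHeartbeats 2000000 in
/-- **THE (1,2,3,3,3,3) MIXED FRAME IS CLASS-DEAD FOR EVERY INTEGRAL CLASS 2-FORM.**  ROW K's
`mixedFrame_classDead` with the leading-digit hypotheses `hC ∕ hp ∕ hX ∕ hB` REPLACED by `mB : B ∈ span`:
`∀ Z ∈ Λ, T₂ ≠ 64·Z` for EVERY integral class 2-form of the mixed type. -/
theorem mixedFrame_classDead_of_mem_span (x : Module.Basis (Fin 12) ℤ M) (Λ : Subalgebra ℤ (ExteriorAlgebra ℤ M))
    (h₀ h₁ l₁ l₂ l₃ l₄ h₂ h₃ h₄ h₅ σ₀ σ₁ σ₂ s t S₁ S₂ D D₂ B B₂ T₂ : ExteriorAlgebra ℤ M)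
    (hΛ : Λ = Algebra.adjoin ℤ (Set.range fun p : M × M => ι ℤ p.1 * ι ℤ p.2))
    (hh₀ : h₀ = ι ℤ (x 0) * ι ℤ (x 1)) (hh₁ : h₁ = ι ℤ (x 2) * ι ℤ (x 3)) (hl₁ : l₁ = ι ℤ (x 0) * ι ℤ (x 2))
    (hl₂ : l₂ = ι ℤ (x 0) * ι ℤ (x 3)) (hl₃ : l₃ = ι ℤ (x 1) * ι ℤ (x 2)) (hl₄ : l₄ = ι ℤ (x 1) * ι ℤ (x 3))
    (hh₂ : h₂ = ι ℤ (x 4) * ι ℤ (x 5)) (hh₃ : h₃ = ι ℤ (x 6) * ι ℤ (x 7)) (hh₄ : h₄ = ι ℤ (x 8) * ι ℤ (x 9))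
    (hh₅ : h₅ = ι ℤ (x 10) * ι ℤ (x 11)) (ms : s ∈ Λ) (mt : t ∈ Λ)
    (hS₁ : S₁ = h₂ + h₃ + h₄ + h₅) (hS₂ : S₂ = h₂ * h₃ + h₂ * h₄ + h₂ * h₅ + h₃ * h₄ + h₃ * h₅ + h₄ * h₅)
    (hD : D = 2 * h₀ + 4 * h₁ + 8 * S₁) (hD₂ : D₂ = 8 * (h₀ * h₁) + 16 * (h₀ * S₁) + 32 * (h₁ * S₁) + 64 * S₂)
    (mB : B ∈ Submodule.span ℤ (Set.range fun p : M × M => ι ℤ p.1 * ι ℤ p.2)) (qB : B * B = 2 * B₂)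
    (hσ₁ : σ₁ = 0) (hσ₂ : σ₂ = 4 * t + 2) (hσ₀ : σ₀ = 2 * s + 1)
    (hT₂ : T₂ = σ₂ * D₂ - 4 * σ₁ * (D * B) + 16 * σ₀ * B₂) :
    ∀ Z ∈ Λ, T₂ ≠ 64 * Z := by
  intro Z mZ hcrit
  obtain ⟨β₀₁, β₂₃, n₁, n₂, n₃, n₄, p, X, mX, hB, hp⟩ := mixed_leadingDigit_of_criterionL_two x h₀ h₁ l₁ l₂ l₃ l₄
    h₂ h₃ h₄ h₅ σ₀ σ₁ σ₂ s t S₁ S₂ D D₂ B B₂ T₂ Z hh₀ hh₁ hl₁ hl₂ hl₃ hl₄ hh₂ hh₃ hh₄ hh₅ hS₁ hS₂ hD hD₂ mB qB hσ₁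
    hσ₂ hσ₀ hT₂ hcrit
  obtain ⟨c, -, -, hXc⟩ := exists_coeff_of_mem_span x X mX
  have hX : X = c 0 1 • (ι ℤ (x 0) * ι ℤ (x 1)) + c 0 2 • (ι ℤ (x 0) * ι ℤ (x 2)) + c 0 3 • (ι ℤ (x 0) * ι ℤ (x 3)) + c 0 4 •
      (ι ℤ (x 0) * ι ℤ (x 4)) + c 0 5 • (ι ℤ (x 0) * ι ℤ (x 5)) + c 0 6 • (ι ℤ (x 0) * ι ℤ (x 6)) + c 0 7 • (ι
      ℤ (x 0) * ι ℤ (x 7)) + c 0 8 • (ι ℤ (x 0) * ι ℤ (x 8)) + c 0 9 • (ι ℤ (x 0) * ι ℤ (x 9)) + c 0 10 • (ι ℤ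
      (x 0) * ι ℤ (x 10)) + c 0 11 • (ι ℤ (x 0) * ι ℤ (x 11)) + c 1 2 • (ι ℤ (x 1) * ι ℤ (x 2)) + c 1 3 • (ι ℤ
      (x 1) * ι ℤ (x 3)) + c 1 4 • (ι ℤ (x 1) * ι ℤ (x 4)) + c 1 5 • (ι ℤ (x 1) * ι ℤ (x 5)) + c 1 6 • (ι ℤ (x
      1) * ι ℤ (x 6)) + c 1 7 • (ι ℤ (x 1) * ι ℤ (x 7)) + c 1 8 • (ι ℤ (x 1) * ι ℤ (x 8)) + c 1 9 • (ι ℤ (x 1)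
      * ι ℤ (x 9)) + c 1 10 • (ι ℤ (x 1) * ι ℤ (x 10)) + c 1 11 • (ι ℤ (x 1) * ι ℤ (x 11)) + c 2 3 • (ι ℤ (x
      2) * ι ℤ (x 3)) + c 2 4 • (ι ℤ (x 2) * ι ℤ (x 4)) + c 2 5 • (ι ℤ (x 2) * ι ℤ (x 5)) + c 2 6 • (ι ℤ (x 2)
      * ι ℤ (x 6)) + c 2 7 • (ι ℤ (x 2) * ι ℤ (x 7)) + c 2 8 • (ι ℤ (x 2) * ι ℤ (x 8)) + c 2 9 • (ι ℤ (x 2) *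
      ι ℤ (x 9)) + c 2 10 • (ι ℤ (x 2) * ι ℤ (x 10)) + c 2 11 • (ι ℤ (x 2) * ι ℤ (x 11)) + c 3 4 • (ι ℤ (x 3)
      * ι ℤ (x 4)) + c 3 5 • (ι ℤ (x 3) * ι ℤ (x 5)) + c 3 6 • (ι ℤ (x 3) * ι ℤ (x 6)) + c 3 7 • (ι ℤ (x 3) *
      ι ℤ (x 7)) + c 3 8 • (ι ℤ (x 3) * ι ℤ (x 8)) + c 3 9 • (ι ℤ (x 3) * ι ℤ (x 9)) + c 3 10 • (ι ℤ (x 3) * ι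
      ℤ (x 10)) + c 3 11 • (ι ℤ (x 3) * ι ℤ (x 11)) + c 4 5 • (ι ℤ (x 4) * ι ℤ (x 5)) + c 4 6 • (ι ℤ (x 4) * ι
      ℤ (x 6)) + c 4 7 • (ι ℤ (x 4) * ι ℤ (x 7)) + c 4 8 • (ι ℤ (x 4) * ι ℤ (x 8)) + c 4 9 • (ι ℤ (x 4) * ι ℤ
      (x 9)) + c 4 10 • (ι ℤ (x 4) * ι ℤ (x 10)) + c 4 11 • (ι ℤ (x 4) * ι ℤ (x 11)) + c 5 6 • (ι ℤ (x 5) * ι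
      ℤ (x 6)) + c 5 7 • (ι ℤ (x 5) * ι ℤ (x 7)) + c 5 8 • (ι ℤ (x 5) * ι ℤ (x 8)) + c 5 9 • (ι ℤ (x 5) * ι ℤ
      (x 9)) + c 5 10 • (ι ℤ (x 5) * ι ℤ (x 10)) + c 5 11 • (ι ℤ (x 5) * ι ℤ (x 11)) + c 6 7 • (ι ℤ (x 6) * ι
      ℤ (x 7)) + c 6 8 • (ι ℤ (x 6) * ι ℤ (x 8)) + c 6 9 • (ι ℤ (x 6) * ι ℤ (x 9)) + c 6 10 • (ι ℤ (x 6) * ι ℤ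
      (x 10)) + c 6 11 • (ι ℤ (x 6) * ι ℤ (x 11)) + c 7 8 • (ι ℤ (x 7) * ι ℤ (x 8)) + c 7 9 • (ι ℤ (x 7) * ι ℤ
      (x 9)) + c 7 10 • (ι ℤ (x 7) * ι ℤ (x 10)) + c 7 11 • (ι ℤ (x 7) * ι ℤ (x 11)) + c 8 9 • (ι ℤ (x 8) * ι
      ℤ (x 9)) + c 8 10 • (ι ℤ (x 8) * ι ℤ (x 10)) + c 8 11 • (ι ℤ (x 8) * ι ℤ (x 11)) + c 9 10 • (ι ℤ (x 9) *
      ι ℤ (x 10)) + c 9 11 • (ι ℤ (x 9) * ι ℤ (x 11)) + c 10 11 • (ι ℤ (x 10) * ι ℤ (x 11)) := by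
    rw [hXc, sum_pairs_twelve]
    simp only [zsmul_eq_mul]
  exact mixedFrame_classDead x Λ h₀ h₁ l₁ l₂ l₃ l₄ h₂ h₃ h₄ h₅ σ₀ σ₁ σ₂ s t S₁ S₂ D D₂ _ X B B₂ T₂ β₀₁ β₂₃ n₁ n₂ n₃
    n₄ p c hΛ hh₀ hh₁ hl₁ hl₂ hl₃ hl₄ hh₂ hh₃ hh₄ hh₅ ms mt hS₁ hS₂ hD hD₂ rfl hp hX hB qB hσ₁ hσ₂ hσ₀ hT₂ Z mZ hcrit

end Summit.Ventures.HSemireg.MixedFrameEveryDigit
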